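import Literature.NumberTheory.ConnesConsani2021.VanishingConditions
import Literature.Analysis.Fourier.BoasKacPointwiseBound
import HarnessLib

/-!
# Connes–Consani 2021, §3: Remark 3.9 (i) with the Boas–Kac bound discharged

RH-FREE (label, line 1); bears on the cell's §3 bookkeeping only (Cor. 3.8 / Rem. 3.9 are
NUMERICAL-IN-PRINT remarks off every closing path).  Nothing here bears on the truth of the Riemann
hypothesis.

`VanishingConditions.lean` types **Connes–Consani 2021, Remark 3.9 (i)** (= arXiv:2006.13771 Rem. 20 (i),
p. 14, chunk p0014:L23–L32) as `rem_3_9_i_of_numericalInput`, with TWO printed inputs as hypotheses: the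
Boas–Kac pointwise bound `hBK` ("the bound given by Theorem 2 of [BK] — typo corrected: ceiling function —
`|f(x)| ≤ f(0) cos(π/(⌈s/x⌉ + 1))` for any positive definite function `f` with support in the interval
`[−s, s]`", R. P. Boas, M. Kac, Duke Math. J. 12 (1945) Thm 2) and the numerical verification `hnum`
("this holds for `s = 0.14043`").  The first is now a TREE THEOREM —
`Literature.Analysis.Fourier.BoasKacPointwise.norm_le_re_apply_zero_mul_cos` (Fejér's first-coefficient
inequality for nonnegative trigonometric polynomials + the Poisson / Fejér–Riesz lattice step; Boas–Kac
1945 Thm 2 = Kolountzakis–Révész 2006 Cor. 1) — and this file reads it for CC's class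
(`IsPositiveDefinite.norm_le_re_zero_mul_cos`, Def. 3.1 + `C_c^∞([−s, s])` = the tree's `Yoshida1992.C s`)
and re-issues the remark with ONLY the floating-point input `hnum` left as a hypothesis
(`rem_3_9_i`), the integrability bookkeeping `hMi` being proved as well.

## References
* A. Connes, C. Consani, *Weil positivity and trace formula, the archimedean place*, Selecta Math. 27
  (2021), §3 Rem. 3.9 (i). [cite: ConnesConsani2021, Rem. 3.9 (i) §3 p. 14]
* R. P. Boas, M. Kac, Duke Math. J. 12 (1945), Thm 2. [cite: BoasKac1945, Thm 2]
-/

noncomputable section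

open MeasureTheory Set Complex Filter FourierTransform
open scoped Real ComplexConjugate

namespace Literature.NumberTheory.ConnesConsani2021

open Literature.NumberTheory.LFunctions

variable {f : ℝ → ℂ}

/-- RH-FREE. **The Boas–Kac pointwise bound for CC's class** ([BK] Theorem 2, the inequality quoted in
Rem. 3.9 (i), "typo corrected: ceiling function"): every positive definite `f ∈ C_c^∞([−s, s])` (Def. 3.1,
`s > 0`) satisfies `|f(x)| ≤ f(0) · cos(π/(⌈s/|x|⌉ + 1))` for `x ≠ 0` — the tree theorem
`Literature.Analysis.Fourier.BoasKacPointwise.norm_le_re_apply_zero_mul_cos` (Boas–Kac 1945 Thm 2 /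
Kolountzakis–Révész 2006 Cor. 1, via Fejér's inequality and Poisson summation) read through
`isPositiveDefinite_iff_fourierIntegral`.  This DISCHARGES the hypothesis `hBK` of
`rem_3_9_i_of_numericalInput`.
[cite: BoasKac1945, Thm 2] [cite: ConnesConsani2021, Rem. 3.9 (i) §3 p. 14 (arXiv Rem. 20 (i), p0014:L23–L27)] -/
theorem IsPositiveDefinite.norm_le_re_zero_mul_cos {s : ℝ} (hs : 0 < s) (hfC : f ∈ Yoshida1992.C s)
    (hpd : IsPositiveDefinite f) {x : ℝ} (hx : x ≠ 0) :
    ‖f x‖ ≤ (f 0).re * Real.cos (π / (⌈s / |x|⌉₊ + 1)) := by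
  rw [Yoshida1992.mem_C] at hfC
  obtain ⟨hf, hfs⟩ := hfC
  have hF := (isPositiveDefinite_iff_fourierIntegral.mp hpd).2
  exact Literature.Analysis.Fourier.BoasKacPointwise.norm_le_re_apply_zero_mul_cos hf.1 hs hfs
    (fun ξ ↦ Complex.nonneg_iff.mpr ⟨(hF ξ).1, (hF ξ).2.symm⟩) hx

/-- `Q₊G = −G″ + G/4` is continuous for `G ∈ C²`. [folklore] -/
private theorem continuous_opQ_of_contDiff {G : ℝ → ℂ} (hG : ContDiff ℝ 2 G) : Continuous (opQ G) := by
  have h1 : ContDiff ℝ 1 (deriv G) := by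
    rw [← one_add_one_eq_two] at hG
    exact hG.deriv'
  have h2 : Continuous (deriv (deriv G)) := h1.continuous_deriv le_rfl
  show Continuous fun t ↦ -deriv (deriv G) t + (1 / 4 : ℂ) * G t
  exact h2.neg.add (continuous_const.mul hG.continuous)

/-- The weight of Rem. 3.9 (i), `x ↦ cos(π/(⌈s/|x|⌉ + 1))`, is measurable and bounded by `1`, so
`‖Q₊k‖ · cos(π/(⌈s/|x|⌉ + 1))` is integrable on `(0, s]` for `k ∈ C²` — the bookkeeping hypothesis `hMi`
of `rem_3_9_i_of_numericalInput`. [folklore] -/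
private theorem integrableOn_norm_opQ_mul_cos {G : ℝ → ℂ} (hG : ContDiff ℝ 2 G) (s : ℝ) :
    IntegrableOn (fun x ↦ ‖opQ G x‖ * Real.cos (π / (⌈s / |x|⌉₊ + 1))) (Ioc 0 s) := by
  have hmeas : Measurable fun x : ℝ ↦ Real.cos (π / (⌈s / |x|⌉₊ + 1)) := by
    have h1 : Measurable fun x : ℝ ↦ ⌈s / |x|⌉₊ :=
      (measurable_const.div continuous_abs.measurable).nat_ceil
    have h2 : Measurable fun x : ℝ ↦ ((⌈s / |x|⌉₊ : ℕ) : ℝ) := measurable_from_nat.comp h1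
    exact Real.measurable_cos.comp (measurable_const.div (h2.add_const 1))
  have hint : IntegrableOn (fun x ↦ ‖opQ G x‖) (Ioc 0 s) :=
    ((continuous_opQ_of_contDiff hG).norm.integrableOn_Icc (a := 0) (b := s)).mono_set
      Ioc_subset_Icc_self
  refine Integrable.mul_bdd hint hmeas.aestronglyMeasurable (c := 1) (Eventually.of_forall fun x ↦ ?_)
  rw [Real.norm_eq_abs]
  exact Real.abs_cos_le_one _

/-- RH-FREE. **Connes–Consani 2021, Remark 3.9 (i)** (= arXiv Rem. 20 (i), p. 14) with the Boas–Kac bound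
DISCHARGED: "One can improve the constant `u` of Corollary 3.8 using the bound given by Theorem 2 of [BK]
`|f(x)| ≤ f(0) cos(π/(⌈s/x⌉ + 1))` for any positive definite function `f` with support in the interval
`[−s, s]`.  The condition on `s` now becomes `∫₀ˢ Q₊δ(ν(x)) cos(π/(⌈s/x⌉ + 1)) dx ≤ 1`.  This holds for
`s = 0.14043` and improves the value of `u` of Corollary 3.8 to `1.15077`."  Same typing as
`rem_3_9_i_of_numericalInput` — generic in the even function `k = G ∘ |·|` (`G ∈ C²`, `G′(0) = 1`; CC:
`G(x) = δ(eˣ)`) — but with ONLY the printed numerical verification `hnum` at `s = 0.14043` as hypothesis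
(NUMERICAL-IN-PRINT, floating point in print; not re-computed here): the pointwise bound is the tree
theorem `IsPositiveDefinite.norm_le_re_zero_mul_cos` and the integrability bookkeeping is proved.
[cite: ConnesConsani2021, Rem. 3.9 (i) §3 p. 14 (arXiv Rem. 20 (i), p0014:L23–L32)] -/
theorem rem_3_9_i {G : ℝ → ℂ} (hG : ContDiff ℝ 2 G) (hG1 : deriv G 0 = 1)
    (hnum : ∫ x in Ioc 0 (0.14043 : ℝ),
      ‖opQ G x‖ * Real.cos (π / (⌈(0.14043 : ℝ) / |x|⌉₊ + 1)) ≤ 1) :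
    IsPositiveOn (-fun f ↦ evenFunctional G (opQ f)) ↑(Yoshida1992.C (0.14043 : ℝ)) :=
  rem_3_9_i_of_numericalInput hG hG1
    (fun _ hfC hpd _ hx ↦ hpd.norm_le_re_zero_mul_cos (by norm_num) hfC hx)
    (integrableOn_norm_opQ_mul_cos hG _) hnum

end Literature.NumberTheory.ConnesConsani2021

end
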